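import Summits.Parity.GeneralizedHardyLittlewood.Theorems.LeeYangFibresRelativeDimOneMoebiusSplitClassSumsAux1
import Summits.Parity.GeneralizedHardyLittlewood.Theorems.LeeYangFibresRelativeDimOneMoebiusSplitClassSumsAux2
import Summits.Parity.GeneralizedHardyLittlewood.Theorems.LeeYangFibresRelativeDimOneMoebiusSplitClassSumsAux4
import Summits.Parity.GeneralizedHardyLittlewood.Theorems.LeeYangFibresRelativeDimOneMoebiusSplitTermBoundAux4
import Mathlib
import HarnessLib

/-!
# Route `LeeYangFibres`, crux `RelativeDimOne` (stmt-Parity-14113), line `single-moebius-split`,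
# stub `stub_termClassSums` — auxiliary file 3: one class sum bounded by the atom

`tcs_perClass`: for `σ = ∑_{i>j} δ_i ≤ η₁ θ` (`θ = δ_j − σ > 0`), `‖Ψ‖_N ≤ L` non-degenerate, `K ⊆ [-N, N]`
convex, a class `(d, e)` with `R_j e ≤ 2LN`, `∏_{i>j} d_i ≤ N^σ`, and the single-Möbius hybrid atom at
`(η₁, C, A, L' = 4L²)` for `Y ≥ Y₀`: `|Σ(d, e)| ≤ 2 log(2LN) (2 S_N + 1)/((θ/2) log N)^A · (2N/M₀ + 1)`,
`S_N = (2e⁵(4j² + 9) log N)^j`, once `L Y₀ ≤ N^θ`, `L² ≤ N^θ`, `k L^C ≤ 2 N^θ`, `8L³ ≤ N`, `N ≥ 3`. Along the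
progression of the class (`tcs_progression`) the sum is an Abel-summed atom sum (`termBound_aux_abel_atom`)
for the dilated system, which is non-degenerate (`tcs_nondegenerate_transport`), `Y^{η₁}`-dilated in the
Möbius form (`|φ̇₀| ≤ L N^σ`, `Y > N^θ/L`), `Y^C`-dilated in the prime forms, with shifts `≤ L` scales, and has
`𝔖 ≤ S_N` (`tcs_singularProduct_le`).
-/

noncomputable section

open scoped BigOperators Classical
open Finset Literature.NumberTheory.Sieve

namespace Summit.Parity.GeneralizedHardyLittlewood.Cruxes.RelativeDimOne.SingleMoebiusSplit

/-- Values of the forms on the box: `|ψ_i(n)| ≤ 2LN` for `n ∈ [-N, N]` when `‖Ψ‖_N ≤ L`. -/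
theorem tcs_abs_eval_le {t : ℕ} {Ψ : Fin t → AffLinForm 1} {N L : ℕ} (hN : 1 ≤ N)
    (hsize : affLinSize Ψ N ≤ L) (i : Fin t) {n : ℤ} (hl : -(N : ℤ) ≤ n) (hu : n ≤ N) :
    |(Ψ i).eval (fun _ => n)| ≤ 2 * L * N := by
  have hsz := natAbs_le_of_affLinSize_le hN hsize i
  have hab : |(Ψ i).coeff 0| ≤ L := by rw [← Int.natCast_natAbs]; exact_mod_cast hsz.1
  have hbb : |(Ψ i).const| ≤ L * N := by rw [← Int.natCast_natAbs]; exact_mod_cast hsz.2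
  have hnn : |n| ≤ N := abs_le.mpr ⟨hl, hu⟩
  rw [DimOne.eval_eq]
  calc |(Ψ i).coeff 0 * n + (Ψ i).const| ≤ |(Ψ i).coeff 0| * |n| + |(Ψ i).const| := by
        rw [← abs_mul]; exact abs_add_le _ _
    _ ≤ L * N + L * N := add_le_add (mul_le_mul hab hnn (abs_nonneg _) (by positivity)) hbb
    _ = 2 * L * N := by ring

/-- **One class sum bounded by the atom** (registered sub-goal for `stub_termClassSums`); see the
module docstring. The hypotheses after the atom are the largeness conditions on `N` (depending on
`k, L, δ, Y₀` only) and the description of the class `(d, e)`. -/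
theorem tcs_perClass : ∀ (k : ℕ) (j : Fin (k + 1)) (η₁ C A θ σ : ℝ) (L L' Y₀ N : ℕ)
    (δ : Fin (k + 1) → ℝ) (Ψ : Fin (k + 1) → AffLinForm 1) (K : Set (Fin 1 → ℝ))
    (d : Fin (k + 1) → ℕ) (e : ℕ) (q : Fin (k + 1) → ℕ),
    j ≠ 0 → IsNondegenerateSystem Ψ → affLinSize Ψ N ≤ L → Convex ℝ K → K ⊆ realBox 1 N →
    (∀ i, 0 < δ i) → σ = ∑ i ∈ Finset.Ioi j, δ i → θ = δ j - σ → 0 < θ →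
    0 < η₁ → η₁ ≤ 1 → σ ≤ η₁ * θ → 0 ≤ C → 1 ≤ θ * C → 0 ≤ A → L' = 4 * L ^ 2 →
    (∀ Y : ℕ, Y₀ ≤ Y → ∀ Φ : Fin ((j : ℕ) + 1) → AffLinForm 1, IsNondegenerateSystem Φ →
      |(((Φ 0).coeff 0 : ℤ) : ℝ)| ≤ L' * (Y : ℝ) ^ η₁ →
      (∑ i : Fin (j : ℕ), |(((Φ i.succ).coeff 0 : ℤ) : ℝ)|) ≤ L' * (Y : ℝ) ^ C →
      (∀ i, |(((Φ i).const : ℤ) : ℝ)| ≤ L' * |(((Φ i).coeff 0 : ℤ) : ℝ)| * Y) →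
      ∀ K' : Set (Fin 1 → ℝ), Convex ℝ K' → K' ⊆ realBox 1 Y →
        |∑ n ∈ (latticeBox 1 Y).filter (fun n => realPoint n ∈ K'),
            (ArithmeticFunction.moebius ((Φ 0).eval n).toNat : ℝ) *
              ∏ i : Fin (j : ℕ), intVonMangoldt ((Φ i.succ).eval n)| ≤
          (archFactor (fun i : Fin (j : ℕ) => Φ i.succ) K' *
              singularProduct (fun i : Fin (j : ℕ) => Φ i.succ) + Y) / Real.log Y ^ A) →
    (L : ℝ) * Y₀ ≤ (N : ℝ) ^ θ → (L : ℝ) ^ 2 ≤ (N : ℝ) ^ θ →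
    (k : ℝ) * (L : ℝ) ^ C ≤ 2 * (N : ℝ) ^ θ → 8 * L ^ 3 ≤ N → 3 ≤ N →
    1 ≤ e → (N : ℝ) ^ (δ j) * e ≤ 2 * L * N → (∀ i ∈ Finset.Ioi j, 1 ≤ d i) →
    (∏ i ∈ Finset.Ioi j, (d i : ℝ)) ≤ (N : ℝ) ^ σ →
    (∀ i, q i = if i ∈ Finset.Ioi j then d i else if i = j then e else 1) →
    |termClassSum Ψ K N ((N : ℝ) ^ (δ j)) j d e| ≤
      2 * Real.log (2 * L * N) *
        ((2 * (2 * Real.exp 5 * ((4 * (j : ℕ) * (j : ℕ) + 9) * Real.log N)) ^ (j : ℕ) + 1) /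
          (θ / 2 * Real.log N) ^ A) *
        (2 * N / ((Finset.univ.lcm (fun i => q i / Int.gcd ((Ψ i).coeff 0) (q i)) : ℕ) : ℝ) + 1) := by
  intro k j η₁ C A θ σ L L' Y₀ N δ Ψ K d e q hj hΨ hsize hK hKN hδ hσ hθ hθ0 hη₁0 hη₁1 hση hC0 hθC
    hA0 hL' hY₀ hNY₀ hNL2 hNkC hN8 hN3 he heR hd hD hq
  have hN1 : 1 ≤ N := by omega
  have hN0 : (0 : ℝ) < N := by exact_mod_cast (show 0 < N by omega)
  have hN1r : (1 : ℝ) ≤ N := by exact_mod_cast hN1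
  have he0r : (0 : ℝ) < e := by exact_mod_cast he
  set a : Fin (k + 1) → ℤ := fun i => (Ψ i).coeff 0 with ha
  have ha0 : ∀ i, a i ≠ 0 := fun i => coeff_zero_ne_zero hΨ i
  have hsz : ∀ i, (a i).natAbs ≤ L ∧ ((Ψ i).const).natAbs ≤ L * N := fun i =>
    natAbs_le_of_affLinSize_le hN1 hsize i
  have hL1 : 1 ≤ L :=
    le_trans (Nat.one_le_iff_ne_zero.mpr (Int.natAbs_ne_zero.mpr (ha0 j))) (hsz j).1
  have hL1r : (1 : ℝ) ≤ L := by exact_mod_cast hL1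
  have haL : ∀ i, |((a i : ℤ) : ℝ)| ≤ L := fun i => by
    have h : |a i| ≤ (L : ℤ) := by rw [← Int.natCast_natAbs]; exact_mod_cast (hsz i).1
    rw [← Int.cast_abs]; exact_mod_cast h
  have ha1 : ∀ i, 1 ≤ |((a i : ℤ) : ℝ)| := fun i => by
    have h : 1 ≤ |a i| := Int.one_le_abs (ha0 i)
    rw [← Int.cast_abs]; exact_mod_cast h
  have hψR : ∀ (i) (n : ℤ), -(N : ℤ) ≤ n → n ≤ N →
      |(((Ψ i).eval (fun _ => n) : ℤ) : ℝ)| ≤ 2 * L * N := fun i n hl hu => by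
    rw [← Int.cast_abs]; exact_mod_cast tcs_abs_eval_le hN1 hsize i hl hu
  have hψN : ∀ (i) (n : ℤ), -(N : ℤ) ≤ n → n ≤ N →
      ((Ψ i).eval (fun _ => n)).natAbs ≤ 2 * L * N := fun i n hl hu => by
    have h := tcs_abs_eval_le hN1 hsize i hl hu
    have h' : ((((Ψ i).eval (fun _ => n)).natAbs : ℕ) : ℤ) ≤ ((2 * L * N : ℕ) : ℤ) := by
      rw [Int.natCast_natAbs]; push_cast; exact h
    exact_mod_cast h'
  set Rj : ℝ := (N : ℝ) ^ (δ j) with hRj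
  clear_value Rj
  have hRj1 : 1 ≤ Rj := by rw [hRj]; exact Real.one_le_rpow hN1r (hδ j).le
  -- the right-hand side is non-negative
  set S : ℝ := (2 * Real.exp 5 * ((4 * (j : ℕ) * (j : ℕ) + 9) * Real.log N)) ^ (j : ℕ) with hS
  clear_value S
  have hN3r : (3 : ℝ) ≤ N := by exact_mod_cast hN3
  have hlogN : 0 < Real.log N := Real.log_pos (by linarith)
  have hS0 : 0 ≤ S := by rw [hS]; exact pow_nonneg (by positivity) _
  have h2LN : (1 : ℝ) ≤ 2 * L * N :=
    one_le_mul_of_one_le_of_one_le (by linarith : (1 : ℝ) ≤ 2 * L) hN1r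
  have hG0 : 0 ≤ Real.log (2 * L * N) := Real.log_nonneg h2LN
  have hden : 0 < (θ / 2 * Real.log N) ^ A := Real.rpow_pos_of_pos (by positivity) A
  set M₀ : ℕ := Finset.univ.lcm (fun i => q i / Int.gcd ((Ψ i).coeff 0) (q i)) with hM₀
  clear_value M₀
  have hq1 : ∀ i, 1 ≤ q i := fun i => by
    rw [hq i]; split_ifs with h1 h2; exacts [hd i h1, he, le_rfl]
  have hM₀1 : 1 ≤ M₀ := by rw [hM₀]; exact one_le_lcm_div_gcd (fun i => (Ψ i).coeff 0) hq1
  have hM₀r : (0 : ℝ) < M₀ := by exact_mod_cast hM₀1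
  have hW0 : 0 ≤ 2 * Real.log (2 * L * N) * ((2 * S + 1) / (θ / 2 * Real.log N) ^ A) := by positivity
  have hlast0 : 0 ≤ 2 * (N : ℝ) / M₀ + 1 := by positivity
  -- the empty class
  by_cases hT : termClassSum Ψ K N Rj j d e = 0
  · rw [hT, abs_zero]; exact mul_nonneg hW0 hlast0
  -- a point of the class
  have hT' := hT
  unfold termClassSum at hT'
  obtain ⟨n₀, hn₀, -⟩ := Finset.exists_ne_zero_of_sum_ne_zero hT'
  rw [Finset.mem_filter, Finset.mem_Icc] at hn₀
  obtain ⟨⟨hn₀l, hn₀u⟩, -, -, hn₀d, hn₀e, -⟩ := hn₀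
  -- the progression of the class
  obtain ⟨Φ, K', w, hK'c, hK'Y, hwmono, hw0, hwG, hA₀, hB₀, hcoef, hP1, hP2, hident⟩ :=
    tcs_progression k j Ψ K N L Rj d e q n₀ M₀ (2 * N / M₀ + 1) hsize hN1 hL1 hK hKN hRj1 he hd hq
      hM₀ rfl hn₀l hn₀u hn₀d hn₀e
  set Y : ℕ := 2 * N / M₀ + 1 with hY
  clear_value Y
  have hYpos : (0 : ℝ) < Y := by rw [hY]; positivity
  have hM₀Z : (M₀ : ℤ) ≠ 0 := by exact_mod_cast (show M₀ ≠ 0 by omega)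
  have he0Z : (e : ℤ) ≠ 0 := by exact_mod_cast (show e ≠ 0 by omega)
  -- non-degeneracy of the dilated system
  have hΦnd : IsNondegenerateSystem Φ := by
    refine tcs_nondegenerate_transport hΨ Φ
      (Fin.cons j (fun i => Fin.castLE j.isLt.le i) : Fin ((j : ℕ) + 1) → Fin (k + 1)) ?_
      (Fin.cons (e : ℤ) (fun _ => 1) : Fin ((j : ℕ) + 1) → ℤ) ?_ n₀ M₀ hM₀Z ?_
    · refine Fin.cons_injective_iff.mpr ⟨?_, Fin.castLE_injective _⟩
      rintro ⟨i, hi⟩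
      have hi' : Fin.castLE j.isLt.le i = j := hi
      have h1 : ((Fin.castLE j.isLt.le i : Fin (k + 1)) : ℕ) < (j : ℕ) := i.isLt
      exact lt_irrefl _ (hi' ▸ h1)
    · exact Fin.cases (by simpa using he0Z) (fun i => by simp)
    · exact Fin.cases (fun m => by simpa using hP1 m) (fun i m => by simpa using hP2 i m)
  have hΦ'nd : IsNondegenerateSystem (fun i : Fin (j : ℕ) => Φ i.succ) := tcs_nondegenerate_tail hΦnd
  -- the moduli
  obtain ⟨D, hDdef⟩ : ∃ D : ℕ, D = ∏ i ∈ Finset.Ioi j, d i := ⟨_, rfl⟩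
  have hprodq : ∏ i, q i = e * D := by rw [hDdef]; exact tcs_prod_moduli j d q e hq
  have hD1 : 0 < D := by rw [hDdef]; exact Finset.prod_pos fun i hi => hd i hi
  have hM₀le : M₀ ≤ e * D := by
    have h := lcm_div_gcd_dvd_prod (fun i => (Ψ i).coeff 0) q
    rw [← hM₀, hprodq] at h
    exact Nat.le_of_dvd (Nat.mul_pos (by omega) hD1) h
  have hDr : (D : ℝ) ≤ (N : ℝ) ^ σ := by rw [hDdef]; push_cast; exact hD
  have hM₀r_le : (M₀ : ℝ) ≤ e * D := by exact_mod_cast hM₀le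
  have hNθ : 0 < (N : ℝ) ^ θ := Real.rpow_pos_of_pos hN0 θ
  have hNθ1 : 1 ≤ (N : ℝ) ^ θ := Real.one_le_rpow hN1r hθ0.le
  -- the key size relation `N^θ · e · D ≤ 2LN`
  have hkey : (N : ℝ) ^ θ * (e * D) ≤ 2 * L * N := by
    calc (N : ℝ) ^ θ * (e * D) ≤ (N : ℝ) ^ θ * (e * (N : ℝ) ^ σ) := by gcongr
      _ = Rj * e := by
          rw [hRj, hθ, show (N : ℝ) ^ (δ j - σ) * (e * (N : ℝ) ^ σ) =
            ((N : ℝ) ^ (δ j - σ) * (N : ℝ) ^ σ) * e by ring, ← Real.rpow_add hN0, sub_add_cancel]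
      _ ≤ 2 * L * N := heR
  have heD : (e : ℝ) * D ≤ 2 * L * N :=
    calc (e : ℝ) * D = 1 * (e * D) := by ring
      _ ≤ (N : ℝ) ^ θ * (e * D) := mul_le_mul_of_nonneg_right hNθ1 (by positivity)
      _ ≤ 2 * L * N := hkey
  have hM₀_2LN : (M₀ : ℝ) ≤ 2 * L * N := hM₀r_le.trans heD
  have hM₀N : M₀ ≤ 2 * L * N := by exact_mod_cast hM₀_2LN
  -- the length `Y` of the progression
  have hYgt : (2 * N : ℝ) / M₀ < Y := by
    have h := tcs_div_lt_floor_add_one (2 * N) M₀ hM₀1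
    rw [hY]; push_cast at h ⊢; exact h
  have hY1 : 2 * (N : ℝ) / (e * D) ≤ 2 * N / M₀ :=
    div_le_div_of_nonneg_left (by positivity) hM₀r hM₀r_le
  have hY2 : (N : ℝ) ^ θ / L ≤ 2 * N / (e * D) := by
    rw [div_le_div_iff₀ (by positivity) (by positivity)]
    exact hkey.trans_eq (by ring)
  have hYlow : (N : ℝ) ^ θ / L < Y := lt_of_le_of_lt (hY2.trans hY1) hYgt
  have hYY₀ : Y₀ ≤ Y := by
    have h1 : (Y₀ : ℝ) ≤ (N : ℝ) ^ θ / L := by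
      rw [le_div_iff₀ (by positivity), mul_comm]; exact hNY₀
    have h2 : (Y₀ : ℝ) < Y := lt_of_le_of_lt h1 hYlow
    exact_mod_cast h2.le
  have hMY : 2 * (N : ℝ) ≤ M₀ * Y := by
    have h := (div_lt_iff₀ hM₀r).mp hYgt
    calc 2 * (N : ℝ) ≤ Y * M₀ := h.le
      _ = M₀ * Y := mul_comm _ _
  -- `log Y ≥ (θ/2) log N`
  have hNθ2 : (N : ℝ) ^ (θ / 2) ≤ (N : ℝ) ^ θ / L := by
    rw [le_div_iff₀ (by positivity)]
    have hsq : (N : ℝ) ^ (θ / 2) * (N : ℝ) ^ (θ / 2) = (N : ℝ) ^ θ := by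
      rw [← Real.rpow_add hN0]; ring_nf
    have h0 : 0 ≤ (N : ℝ) ^ (θ / 2) := by positivity
    have hLle : (L : ℝ) ≤ (N : ℝ) ^ (θ / 2) := by
      by_contra hlt
      push Not at hlt
      exact absurd hNL2 (not_le.mpr (by rw [← hsq, sq]; exact mul_lt_mul'' hlt hlt h0 h0))
    calc (N : ℝ) ^ (θ / 2) * L ≤ (N : ℝ) ^ (θ / 2) * (N : ℝ) ^ (θ / 2) := by gcongr
      _ = (N : ℝ) ^ θ := hsq
  have hlogY : θ / 2 * Real.log N ≤ Real.log Y := by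
    rw [← Real.log_rpow hN0]
    exact Real.log_le_log (by positivity) (hNθ2.trans hYlow.le)
  have hlogYA : (θ / 2 * Real.log N) ^ A ≤ Real.log Y ^ A := Real.rpow_le_rpow (by positivity) hlogY hA0
  have hlogYpos : 0 < Real.log Y ^ A := Real.rpow_pos_of_pos (lt_of_lt_of_le (by positivity) hlogY) A
  -- the Möbius coefficient `e |φ̇₀| = |ψ̇_j| M₀`
  have hL'r : (L' : ℝ) = 4 * (L : ℝ) ^ 2 := by rw [hL']; push_cast; ring
  have hLL' : (L : ℝ) ≤ L' := by
    rw [hL'r]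
    calc (L : ℝ) ≤ L * L := le_mul_of_one_le_left (by positivity) hL1r
      _ ≤ 4 * (L * L) := le_mul_of_one_le_left (by positivity) (by norm_num)
      _ = 4 * (L : ℝ) ^ 2 := by ring
  have hA₀r : (e : ℝ) * |(((Φ 0).coeff 0 : ℤ) : ℝ)| = |((a j : ℤ) : ℝ)| * M₀ := by
    have h : (e : ℝ) * (((Φ 0).coeff 0 : ℤ) : ℝ) = ((a j : ℤ) : ℝ) * (M₀ : ℝ) := by
      exact_mod_cast hA₀
    calc (e : ℝ) * |(((Φ 0).coeff 0 : ℤ) : ℝ)| = |(e : ℝ) * (((Φ 0).coeff 0 : ℤ) : ℝ)| := by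
          rw [abs_mul, abs_of_nonneg he0r.le]
      _ = |((a j : ℤ) : ℝ)| * M₀ := by rw [h, abs_mul, abs_of_nonneg hM₀r.le]
  have hA₀le : |(((Φ 0).coeff 0 : ℤ) : ℝ)| ≤ L * D := by
    have h1 : (e : ℝ) * |(((Φ 0).coeff 0 : ℤ) : ℝ)| ≤ (e : ℝ) * (L * D) := by
      rw [hA₀r]
      calc |((a j : ℤ) : ℝ)| * M₀ ≤ L * (e * D) :=
            mul_le_mul (haL j) hM₀r_le hM₀r.le (by positivity)
        _ = e * (L * D) := by ring
    exact le_of_mul_le_mul_left h1 he0r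
  have hA₀ge : (M₀ : ℝ) ≤ (e : ℝ) * |(((Φ 0).coeff 0 : ℤ) : ℝ)| := by
    rw [hA₀r]
    calc (M₀ : ℝ) = 1 * M₀ := (one_mul _).symm
      _ ≤ |((a j : ℤ) : ℝ)| * M₀ := mul_le_mul_of_nonneg_right (ha1 j) hM₀r.le
  -- (b) the Möbius dilation `|φ̇₀| ≤ L' Y^{η₁}`
  have hmob : |(((Φ 0).coeff 0 : ℤ) : ℝ)| ≤ L' * (Y : ℝ) ^ η₁ := by
    have h1 : |(((Φ 0).coeff 0 : ℤ) : ℝ)| ≤ L * (N : ℝ) ^ (η₁ * θ) :=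
      calc |(((Φ 0).coeff 0 : ℤ) : ℝ)| ≤ L * D := hA₀le
        _ ≤ L * (N : ℝ) ^ σ := by gcongr
        _ ≤ L * (N : ℝ) ^ (η₁ * θ) :=
            mul_le_mul_of_nonneg_left (Real.rpow_le_rpow_of_exponent_le hN1r hση) (by positivity)
    have h3 : (N : ℝ) ^ (η₁ * θ) = ((N : ℝ) ^ θ / L) ^ η₁ * (L : ℝ) ^ η₁ := by
      rw [← Real.mul_rpow (by positivity) (by positivity), div_mul_cancel₀ _ (by positivity),
        mul_comm, Real.rpow_mul hN0.le]
    have h5 : ((N : ℝ) ^ θ / L) ^ η₁ ≤ (Y : ℝ) ^ η₁ := Real.rpow_le_rpow (by positivity) hYlow.le hη₁0.le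
    have h6 : (L : ℝ) ^ η₁ ≤ L := by
      conv_rhs => rw [← Real.rpow_one (L : ℝ)]
      exact Real.rpow_le_rpow_of_exponent_le hL1r hη₁1
    have hYη : 0 ≤ (Y : ℝ) ^ η₁ := by positivity
    calc |(((Φ 0).coeff 0 : ℤ) : ℝ)| ≤ L * (((N : ℝ) ^ θ / L) ^ η₁ * (L : ℝ) ^ η₁) := by
          rw [← h3]; exact h1
      _ ≤ L * ((Y : ℝ) ^ η₁ * L) := by gcongr
      _ = (L : ℝ) ^ 2 * (Y : ℝ) ^ η₁ := by ring
      _ ≤ 4 * ((L : ℝ) ^ 2 * (Y : ℝ) ^ η₁) := le_mul_of_one_le_left (by positivity) (by norm_num)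
      _ = L' * (Y : ℝ) ^ η₁ := by rw [hL'r]; ring
  -- (c) the prime dilation `∑ |φ̇_{i+1}| ≤ L' Y^C`
  have hjk : (j : ℕ) ≤ k := Nat.lt_succ_iff.mp j.isLt
  have hcoefR : ∀ i : Fin (j : ℕ), |(((Φ i.succ).coeff 0 : ℤ) : ℝ)| =
      |((a (Fin.castLE j.isLt.le i) : ℤ) : ℝ)| * M₀ := fun i => by
    rw [(hcoef i).1]; push_cast; rw [abs_mul, abs_of_nonneg hM₀r.le]
  have hprime : (∑ i : Fin (j : ℕ), |(((Φ i.succ).coeff 0 : ℤ) : ℝ)|) ≤ L' * (Y : ℝ) ^ C := by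
    have h2 : (∑ i : Fin (j : ℕ), |(((Φ i.succ).coeff 0 : ℤ) : ℝ)|) ≤ (j : ℕ) * (L * M₀) := by
      calc _ ≤ ∑ _i : Fin (j : ℕ), ((L : ℝ) * M₀) := Finset.sum_le_sum fun i _ => by
            rw [hcoefR i]; exact mul_le_mul_of_nonneg_right (haL _) hM₀r.le
        _ = (j : ℕ) * (L * M₀) := by
            rw [Finset.sum_const, Finset.card_univ, Fintype.card_fin, nsmul_eq_mul]
    have h3 : (M₀ : ℝ) ≤ 2 * L * N / (N : ℝ) ^ θ := by
      rw [le_div_iff₀ hNθ]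
      calc (M₀ : ℝ) * (N : ℝ) ^ θ ≤ (e * D) * (N : ℝ) ^ θ := by gcongr
        _ = (N : ℝ) ^ θ * (e * D) := by ring
        _ ≤ 2 * L * N := hkey
    have hLC : 0 < (L : ℝ) ^ C := by positivity
    have h4 : (N : ℝ) / (L : ℝ) ^ C ≤ (Y : ℝ) ^ C := by
      have h41 : ((N : ℝ) ^ θ / L) ^ C ≤ (Y : ℝ) ^ C := Real.rpow_le_rpow (by positivity) hYlow.le hC0
      have h42 : ((N : ℝ) ^ θ / L) ^ C = (N : ℝ) ^ (θ * C) / (L : ℝ) ^ C := by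
        rw [Real.div_rpow (by positivity) (by positivity), ← Real.rpow_mul hN0.le]
      have h43 : (N : ℝ) ≤ (N : ℝ) ^ (θ * C) := by
        conv_lhs => rw [← Real.rpow_one (N : ℝ)]
        exact Real.rpow_le_rpow_of_exponent_le hN1r hθC
      calc (N : ℝ) / (L : ℝ) ^ C ≤ (N : ℝ) ^ (θ * C) / (L : ℝ) ^ C :=
            div_le_div_of_nonneg_right h43 hLC.le
        _ = ((N : ℝ) ^ θ / L) ^ C := h42.symm
        _ ≤ (Y : ℝ) ^ C := h41
    have h5 : 2 * k * (L : ℝ) ^ 2 * N / (N : ℝ) ^ θ ≤ 4 * (L : ℝ) ^ 2 * N / (L : ℝ) ^ C := by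
      rw [div_le_div_iff₀ hNθ hLC]
      have h := mul_le_mul_of_nonneg_right hNkC (show (0 : ℝ) ≤ 2 * (L : ℝ) ^ 2 * N by positivity)
      calc 2 * k * (L : ℝ) ^ 2 * N * (L : ℝ) ^ C = k * (L : ℝ) ^ C * (2 * (L : ℝ) ^ 2 * N) := by ring
        _ ≤ 2 * (N : ℝ) ^ θ * (2 * (L : ℝ) ^ 2 * N) := h
        _ = 4 * (L : ℝ) ^ 2 * N * (N : ℝ) ^ θ := by ring
    calc (∑ i : Fin (j : ℕ), |(((Φ i.succ).coeff 0 : ℤ) : ℝ)|) ≤ (j : ℕ) * (L * M₀) := h2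
      _ ≤ k * (L * M₀) := by gcongr
      _ ≤ k * (L * (2 * L * N / (N : ℝ) ^ θ)) := by gcongr
      _ = 2 * k * (L : ℝ) ^ 2 * N / (N : ℝ) ^ θ := by ring
      _ ≤ 4 * (L : ℝ) ^ 2 * N / (L : ℝ) ^ C := h5
      _ = 4 * (L : ℝ) ^ 2 * (N / (L : ℝ) ^ C) := by ring
      _ ≤ 4 * (L : ℝ) ^ 2 * (Y : ℝ) ^ C := by gcongr
      _ = L' * (Y : ℝ) ^ C := by rw [hL'r]
  -- (d) the shifts `|φ_u(0)| ≤ L' |φ̇_u| Y`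
  have hshift : ∀ i, |(((Φ i).const : ℤ) : ℝ)| ≤ L' * |(((Φ i).coeff 0 : ℤ) : ℝ)| * Y := by
    refine Fin.cases ?_ (fun i => ?_)
    · have hB : (e : ℝ) * |(((Φ 0).const : ℤ) : ℝ)| ≤ 2 * L * N := by
        have h : (e : ℝ) * (((Φ 0).const : ℤ) : ℝ) = (((Ψ j).eval (fun _ => n₀) : ℤ) : ℝ) := by
          exact_mod_cast hB₀
        rw [show (e : ℝ) * |(((Φ 0).const : ℤ) : ℝ)| = |(e : ℝ) * (((Φ 0).const : ℤ) : ℝ)| by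
          rw [abs_mul, abs_of_nonneg he0r.le], h]
        exact hψR j n₀ hn₀l hn₀u
      have h1 : (e : ℝ) * |(((Φ 0).const : ℤ) : ℝ)| ≤
          (e : ℝ) * (L * |(((Φ 0).coeff 0 : ℤ) : ℝ)| * Y) :=
        calc (e : ℝ) * |(((Φ 0).const : ℤ) : ℝ)| ≤ 2 * L * N := hB
          _ = L * (2 * N) := by ring
          _ ≤ L * (M₀ * Y) := by gcongr
          _ ≤ L * ((e * |(((Φ 0).coeff 0 : ℤ) : ℝ)|) * Y) := by gcongr
          _ = (e : ℝ) * (L * |(((Φ 0).coeff 0 : ℤ) : ℝ)| * Y) := by ring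
      have h2 := le_of_mul_le_mul_left h1 he0r
      calc |(((Φ 0).const : ℤ) : ℝ)| ≤ L * |(((Φ 0).coeff 0 : ℤ) : ℝ)| * Y := h2
        _ ≤ L' * |(((Φ 0).coeff 0 : ℤ) : ℝ)| * Y := by gcongr
    · have hc1 : (M₀ : ℝ) ≤ |(((Φ i.succ).coeff 0 : ℤ) : ℝ)| := by
        rw [hcoefR i]
        calc (M₀ : ℝ) = 1 * M₀ := (one_mul _).symm
          _ ≤ _ := mul_le_mul_of_nonneg_right (ha1 _) hM₀r.le
      calc |(((Φ i.succ).const : ℤ) : ℝ)| ≤ 2 * L * N := by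
            rw [(hcoef i).2]; exact hψR _ n₀ hn₀l hn₀u
        _ = L * (2 * N) := by ring
        _ ≤ L * (M₀ * Y) := by gcongr
        _ ≤ L * (|(((Φ i.succ).coeff 0 : ℤ) : ℝ)| * Y) := by gcongr
        _ = L * |(((Φ i.succ).coeff 0 : ℤ) : ℝ)| * Y := by ring
        _ ≤ L' * |(((Φ i.succ).coeff 0 : ℤ) : ℝ)| * Y := by gcongr
  -- Abel summation against the atom
  have h𝔖0 : 0 ≤ singularProduct (fun i : Fin (j : ℕ) => Φ i.succ) := singularProduct_nonneg' hΦ'nd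
  have habel := termBound_aux_abel_atom (j : ℕ) Y A (Real.log (2 * L * N)) Φ K' w hK'c hK'Y h𝔖0
    hwmono hw0 hwG (fun K'' hK''c hK''Y => hY₀ Y hYY₀ Φ hΦnd hmob hprime hshift K'' hK''c hK''Y)
  rw [← hident] at habel
  -- the singular series of the prime forms
  have h2LL : 2 * L * L ≤ N := by
    refine le_trans ?_ hN8
    calc 2 * L * L = 2 * L * L * 1 := by ring
      _ ≤ 8 * L * L * L := Nat.mul_le_mul (Nat.mul_le_mul (Nat.mul_le_mul (by norm_num) le_rfl) le_rfl) hL1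
      _ = 8 * L ^ 3 := by ring
  have hcN : ∀ i : Fin (j : ℕ), ((Φ i.succ).coeff 0).natAbs ≤ 2 * L * L * N := by
    intro i
    rw [(hcoef i).1, Int.natAbs_mul, Int.natAbs_natCast]
    calc (a (Fin.castLE j.isLt.le i)).natAbs * M₀ ≤ L * (2 * L * N) := Nat.mul_le_mul (hsz _).1 hM₀N
      _ = 2 * L * L * N := by ring
  have hbN : ∀ i : Fin (j : ℕ), ((Φ i.succ).const).natAbs ≤ 2 * L * N := fun i => by
    rw [(hcoef i).2]; exact hψN _ n₀ hn₀l hn₀u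
  have hN4 : N * N * N ≤ N ^ 4 :=
    calc N * N * N = N ^ 3 := by ring
      _ ≤ N ^ 4 := Nat.pow_le_pow_right hN1 (by norm_num)
  have hc4 : ∀ i : Fin (j : ℕ), ((Φ i.succ).coeff 0).natAbs ≤ N ^ 4 := fun i =>
    calc ((Φ i.succ).coeff 0).natAbs ≤ 2 * L * L * N := hcN i
      _ ≤ N * N := Nat.mul_le_mul_right _ h2LL
      _ ≤ N * N * N := Nat.le_mul_of_pos_right _ (by omega)
      _ ≤ N ^ 4 := hN4
  have hm4 : ∀ i i' : Fin (j : ℕ), ((Φ i.succ).coeff 0 * (Φ i'.succ).const -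
      (Φ i'.succ).coeff 0 * (Φ i.succ).const).natAbs ≤ N ^ 4 := by
    intro i i'
    calc _ ≤ ((Φ i.succ).coeff 0 * (Φ i'.succ).const).natAbs +
          ((Φ i'.succ).coeff 0 * (Φ i.succ).const).natAbs := Int.natAbs_sub_le _ _
      _ = ((Φ i.succ).coeff 0).natAbs * ((Φ i'.succ).const).natAbs +
          ((Φ i'.succ).coeff 0).natAbs * ((Φ i.succ).const).natAbs := by
          rw [Int.natAbs_mul, Int.natAbs_mul]
      _ ≤ (2 * L * L * N) * (2 * L * N) + (2 * L * L * N) * (2 * L * N) :=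
          add_le_add (Nat.mul_le_mul (hcN i) (hbN i')) (Nat.mul_le_mul (hcN i') (hbN i))
      _ = (8 * L ^ 3) * N * N := by ring
      _ ≤ N * N * N := by gcongr
      _ ≤ N ^ 4 := hN4
  have h𝔖 : singularProduct (fun i : Fin (j : ℕ) => Φ i.succ) ≤ S := by
    rw [hS]
    exact tcs_singularProduct_le (j : ℕ) (fun i : Fin (j : ℕ) => Φ i.succ) hΦ'nd N hN3 hc4 hm4
  -- assemble
  have hYle : (Y : ℝ) ≤ 2 * N / M₀ + 1 := by
    rw [hY]; push_cast
    have : ((2 * N / M₀ : ℕ) : ℝ) ≤ 2 * N / M₀ := by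
      calc ((2 * N / M₀ : ℕ) : ℝ) ≤ ((2 * N : ℕ) : ℝ) / M₀ := Nat.cast_div_le
        _ = 2 * N / M₀ := by push_cast; ring
    linarith only [this]
  calc |termClassSum Ψ K N Rj j d e|
      ≤ 2 * Real.log (2 * L * N) * ((2 * Y * singularProduct (fun i : Fin (j : ℕ) => Φ i.succ) + Y) /
          Real.log Y ^ A) := habel
    _ ≤ 2 * Real.log (2 * L * N) * ((2 * S + 1) * Y / (θ / 2 * Real.log N) ^ A) := by
        refine mul_le_mul_of_nonneg_left ?_ (by positivity)
        have hnum : 2 * Y * singularProduct (fun i : Fin (j : ℕ) => Φ i.succ) + Y ≤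
            (2 * S + 1) * Y :=
          calc 2 * Y * singularProduct (fun i : Fin (j : ℕ) => Φ i.succ) + Y ≤ 2 * Y * S + Y :=
                add_le_add (mul_le_mul_of_nonneg_left h𝔖 (show (0 : ℝ) ≤ 2 * Y by positivity))
                  le_rfl
            _ = (2 * S + 1) * Y := by ring
        have hnum0 : 0 ≤ (2 * S + 1) * Y := by positivity
        calc _ ≤ (2 * S + 1) * Y / Real.log Y ^ A := div_le_div_of_nonneg_right hnum hlogYpos.le
          _ ≤ (2 * S + 1) * Y / (θ / 2 * Real.log N) ^ A :=
              div_le_div_of_nonneg_left hnum0 hden hlogYA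
    _ = 2 * Real.log (2 * L * N) * ((2 * S + 1) / (θ / 2 * Real.log N) ^ A) * Y := by ring
    _ ≤ 2 * Real.log (2 * L * N) * ((2 * S + 1) / (θ / 2 * Real.log N) ^ A) * (2 * N / M₀ + 1) :=
        mul_le_mul_of_nonneg_left hYle hW0

end Summit.Parity.GeneralizedHardyLittlewood.Cruxes.RelativeDimOne.SingleMoebiusSplit
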